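import Summits.Ventures.LatticeQCDFlow.Scaling.IdealStarAugmentation
import Summits.Ventures.LatticeQCDFlow.Scaling.DirtySetDecay

/-!
HONEST FRAMING: exact (Metropolis-corrected) sampling algorithms for lattice gauge theory; figures
of merit are autocorrelation/cost numbers at stated couplings and volumes; no continuum-physics
claim.

# IdealStarFreshness — CLEAN POSITIONS ARE EXACTLY `ν`-DISTRIBUTED: ALONG THE AUGMENTED CHAIN OF THE IDEALISED STAR,
# EVERY COORDINATE OUTSIDE THE STALE SET IS `ν`-EXCHANGEABLE (`ν̂(z[k ↦ v], D)·ν(z_k) = ν̂(z, D)·ν(v)` FOR `k ∉ D`),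
# HENCE `δ_x Pⁿ ≥ P(D_n = ∅)·π̃` POINTWISE AND `‖δ_x Pⁿ − π̃‖_TV ≤ P(D_n ≠ ∅)` (lean-2 GEN-24, ours)

Venture-side (OURS).  Cell `lqcd-flow` (pub-lqcd), unit `pub-lqcd-lean-2-g24`, 2026-08-27.  Chapter L (the coupon-collector
law from a cold start), file 14 — the ceiling side, the probabilistic heart.  Setting and augmented chain `P̂` of
`Scaling/IdealStarAugmentation` (hub list `κ`, one law `ν` at every level, identity maps, exact hot sampler
`M_0(u,v) = ν(v)`, hot-only updates; tag = the stale set `D`).  The path-space statement "given the schedule, the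
configurations at clean positions are i.i.d. `ν`, independent of everything else" is rendered as an invariant of the
law `ν̂_n = δ_{(x, univ)} P̂ⁿ` that is LOCAL and LINEAR, hence checkable move by move:
FRESH-EXCHANGEABILITY `ν̂(z[k ↦ v], D)·ν(z_k) = ν̂(z, D)·ν(v)` for every `k ∉ D`.

## What is proved

* §1 `tensorFun_update_mul_const`; **`ideal_fresh_step`** — fresh-exchangeability is preserved by one step of `P̂`
  (swaps carry it through the transposition; a refresh re-randomises position `0` by `ν` and commutes with updates
  elsewhere); **`ideal_fresh_lawAt`** — it holds for `ν̂_n` at all times (vacuous at `n = 0`, where `D = univ`).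
* §2 **`fresh_empty_proportional`** — a fresh-exchangeable `λ` is proportional to `π̃ = ν^{⊗(K+1)}` on the tag `∅`:
  `λ(z,∅)·π̃(z') = λ(z',∅)·π̃(z)` (induction on the number of coordinates where `z, z'` differ);
  **`ideal_lawAt_empty_eq`** — `ν̂_n(z, ∅) = (δ_{univ}Qⁿ)(∅)·π̃(z)`.
* §3 **`ideal_minorization`** — `(δ_x Pⁿ)(z) ≥ (δ_{univ}Qⁿ)(∅)·π̃(z)` for every `x`, `z`, `n`;
  `tvDist_le_of_pointwise_ge` (a probability vector minorised by `c·π` is within `1 − c` of `π`);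
  **`ideal_tvDist_le_stale` (THE FRESHNESS BOUND)** — `‖δ_x Pⁿ − π̃‖_TV ≤ (δ_{univ}Qⁿ){D ≠ ∅}`.

Reading (no numerics implied): the idealised star is as far from equilibrium as the probability that some replica
still carries never-refreshed material; `Scaling/DirtySetDecay` bounds that probability by `(K+1)·λⁿ/t`, and the
sequel turns it into the `K·log K` mixing ceiling.  NOT CLAIMED: non-identity maps, unequal laws, inexact hot samplers
(each would break acceptance-one or the `ν`-refresh).  Literature grade (cell rule): OWN CONSTRUCTION (a
coupling-from-genealogy argument typed as a linear invariant); nothing cited as a fact; no new bib keys.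
-/

noncomputable section

open Finset Function
open Literature.Probability.MarkovChains

namespace Summit.Ventures.LatticeQCDFlow.Scaling

variable {S : Type*} [Fintype S] [DecidableEq S] {K m : ℕ} {ν : S → ℝ} {M : Fin (K + 1) → S → S → ℝ} {t : ℝ}

/-! ## §1 Fresh-exchangeability is preserved -/

omit [Fintype S] [DecidableEq S] in
/-- `π̃(x[j ↦ v])·ν(x_j) = π̃(x)·ν(v)` for the constant family `π̃ = ν^{⊗(K+1)}`. [ours] -/
theorem tensorFun_update_mul_const (ν : S → ℝ) (x : Fin (K + 1) → S) (j : Fin (K + 1)) (v : S) :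
    tensorFun (fun _ : Fin (K + 1) => ν) (update x j v) * ν (x j) = tensorFun (fun _ : Fin (K + 1) => ν) x * ν v := by
  rw [tensorFun_update (fun _ : Fin (K + 1) => ν) x j v, tensorFun_eq_mul_prod (fun _ : Fin (K + 1) => ν) x j]
  ring

section Fresh
variable (κ : Fin m → Fin K)

/-- **FRESH-EXCHANGEABILITY IS PRESERVED BY ONE STEP** of the augmented chain (`M_0(u,v) = ν(v)`): if
`λ(z[k ↦ v], D)·ν(z_k) = λ(z, D)·ν(v)` for all `k ∉ D`, the same holds for `λP̂`. [ours] -/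
theorem ideal_fresh_step (hM0 : ∀ u v, M 0 u v = ν v)
    {Ph : (Fin (K + 1) → S) × Finset (Fin (K + 1)) → (Fin (K + 1) → S) × Finset (Fin (K + 1)) → ℝ}
    (hPh : ∀ p q, Ph p q = ∑ r : Fin m, t / m *
        (if q.1 = edgeFlowSwap (Equiv.refl S) 0 (κ r).succ p.1 ∧ q.2 = p.2.image (Equiv.swap (0 : Fin (K + 1)) (κ r).succ)
          then (1 : ℝ) else 0)
      + (1 - t) * (coordKernel M 0 p.1 q.1 * (if q.2 = p.2.erase 0 then (1 : ℝ) else 0)))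
    {lam : (Fin (K + 1) → S) × Finset (Fin (K + 1)) → ℝ}
    (hlam : ∀ (z : Fin (K + 1) → S) (D : Finset (Fin (K + 1))) (k : Fin (K + 1)) (v : S), k ∉ D →
      lam (update z k v, D) * ν (z k) = lam (z, D) * ν v) :
    ∀ (z : Fin (K + 1) → S) (D : Finset (Fin (K + 1))) (k : Fin (K + 1)) (v : S), k ∉ D →
      stepLaw Ph lam (update z k v, D) * ν (z k) = stepLaw Ph lam (z, D) * ν v := by
  have he := hubList_fst_ne_snd (K := K) κ
  intro z D k v hk
  rw [ideal_stepLaw_apply κ hPh lam (update z k v) D, ideal_stepLaw_apply κ hPh lam z D, add_mul, add_mul,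
    Finset.sum_mul, Finset.sum_mul]
  congr 1
  · -- swaps: transport the relation through the transposition `σ = (0 κ_r+1)`
    refine sum_congr rfl fun r _ => ?_
    have hsw : edgeFlowSwap (Equiv.refl S) 0 (κ r).succ (update z k v)
        = update (edgeFlowSwap (Equiv.refl S) 0 (κ r).succ z) (Equiv.swap (0 : Fin (K + 1)) (κ r).succ k) v := by
      rw [edgeFlowSwap_one (he r), edgeFlowSwap_one (he r), Function.update_comp_equiv, Equiv.symm_swap]
    have hzk : z k = (edgeFlowSwap (Equiv.refl S) 0 (κ r).succ z) (Equiv.swap (0 : Fin (K + 1)) (κ r).succ k) := by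
      rw [edgeFlowSwap_one (he r), Function.comp_apply, Equiv.swap_apply_self]
    have hk' : Equiv.swap (0 : Fin (K + 1)) (κ r).succ k ∉ D.image (Equiv.swap (0 : Fin (K + 1)) (κ r).succ) := by
      rw [Finset.mem_image]
      rintro ⟨j, hj, hjk⟩
      exact hk ((Equiv.swap (0 : Fin (K + 1)) (κ r).succ).injective hjk ▸ hj)
    rw [hsw, hzk, mul_assoc, hlam _ _ _ _ hk', ← mul_assoc]
  · -- refreshes
    rw [mul_assoc, mul_assoc]
    congr 1
    rw [Finset.sum_mul, Finset.sum_mul]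
    refine sum_congr rfl fun D₀ hD₀ => ?_
    have hD₀' : D₀.erase 0 = D := (Finset.mem_filter.mp hD₀).2
    rw [Finset.sum_mul, Finset.sum_mul]
    refine sum_congr rfl fun u _ => ?_
    simp_rw [hM0]
    by_cases hk0 : k = 0
    · subst hk0
      rw [update_idem, update_self]
      ring
    · have hkD₀ : k ∉ D₀ := fun h => hk (hD₀' ▸ Finset.mem_erase.mpr ⟨hk0, h⟩)
      rw [update_comm hk0, update_of_ne (Ne.symm hk0)]
      have h := hlam (update z 0 u) D₀ k v hkD₀
      rw [update_of_ne hk0] at h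
      calc lam (update (update z 0 u) k v, D₀) * ν (z 0) * ν (z k)
          = (lam (update (update z 0 u) k v, D₀) * ν (z k)) * ν (z 0) := by ring
        _ = (lam (update z 0 u, D₀) * ν v) * ν (z 0) := by rw [h]
        _ = lam (update z 0 u, D₀) * ν (z 0) * ν v := by ring

/-- **FRESH-EXCHANGEABILITY AT ALL TIMES:** from `δ_{(x, univ)}`, `ν̂_n(z[k ↦ v], D)·ν(z_k) = ν̂_n(z, D)·ν(v)` for every
`n`, `z`, `D`, `v` and `k ∉ D`. [ours] -/
theorem ideal_fresh_lawAt (hM0 : ∀ u v, M 0 u v = ν v)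
    {Ph : (Fin (K + 1) → S) × Finset (Fin (K + 1)) → (Fin (K + 1) → S) × Finset (Fin (K + 1)) → ℝ}
    (hPh : ∀ p q, Ph p q = ∑ r : Fin m, t / m *
        (if q.1 = edgeFlowSwap (Equiv.refl S) 0 (κ r).succ p.1 ∧ q.2 = p.2.image (Equiv.swap (0 : Fin (K + 1)) (κ r).succ)
          then (1 : ℝ) else 0)
      + (1 - t) * (coordKernel M 0 p.1 q.1 * (if q.2 = p.2.erase 0 then (1 : ℝ) else 0)))
    (x : Fin (K + 1) → S) :
    ∀ (n : ℕ) (z : Fin (K + 1) → S) (D : Finset (Fin (K + 1))) (k : Fin (K + 1)) (v : S), k ∉ D →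
      lawAt Ph (Pi.single (x, (univ : Finset (Fin (K + 1)))) 1) n (update z k v, D) * ν (z k)
        = lawAt Ph (Pi.single (x, (univ : Finset (Fin (K + 1)))) 1) n (z, D) * ν v := by
  intro n
  induction n with
  | zero =>
    intro z D k v hk
    have hD : D ≠ univ := fun h => hk (h ▸ mem_univ k)
    rw [lawAt_zero, Pi.single_eq_of_ne (fun h => hD (Prod.mk.inj h).2),
      Pi.single_eq_of_ne (fun h => hD (Prod.mk.inj h).2), zero_mul, zero_mul]
  | succ n ih =>
    intro z D k v hk
    rw [lawAt_succ]
    exact ideal_fresh_step κ hM0 hPh ih z D k v hk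

/-! ## §2 On the empty tag the law is proportional to `π̃` -/

omit [Fintype S] in
/-- **A fresh-exchangeable function is proportional to `π̃` on the tag `∅`:**
`λ(z, ∅)·π̃(z') = λ(z', ∅)·π̃(z)` (`ν > 0`). [ours] -/
theorem fresh_empty_proportional (hν : ∀ v, 0 < ν v) {lam : (Fin (K + 1) → S) × Finset (Fin (K + 1)) → ℝ}
    (hlam : ∀ (z : Fin (K + 1) → S) (D : Finset (Fin (K + 1))) (k : Fin (K + 1)) (v : S), k ∉ D →
      lam (update z k v, D) * ν (z k) = lam (z, D) * ν v) :
    ∀ z z' : Fin (K + 1) → S, lam (z, ∅) * tensorFun (fun _ : Fin (K + 1) => ν) z'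
      = lam (z', ∅) * tensorFun (fun _ : Fin (K + 1) => ν) z := by
  -- induction on the number of coordinates where `z` and `z'` differ
  suffices h : ∀ (d : ℕ) (z z' : Fin (K + 1) → S), (univ.filter (fun k => z k ≠ z' k)).card ≤ d →
      lam (z, ∅) * tensorFun (fun _ : Fin (K + 1) => ν) z' = lam (z', ∅) * tensorFun (fun _ : Fin (K + 1) => ν) z from
    fun z z' => h _ z z' le_rfl
  intro d
  induction d with
  | zero =>
    intro z z' hd
    have hzz : z = z' := by
      funext k
      by_contra hne
      have : k ∈ univ.filter (fun k => z k ≠ z' k) := Finset.mem_filter.mpr ⟨mem_univ _, hne⟩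
      exact absurd (Finset.card_pos.mpr ⟨k, this⟩) (by omega)
    rw [hzz]
  | succ d ih =>
    intro z z' hd
    by_cases hzz : z = z'
    · rw [hzz]
    · -- pick a coordinate where they differ and fix it
      obtain ⟨k, hk⟩ : ∃ k, z k ≠ z' k := by
        by_contra hne
        push Not at hne
        exact hzz (funext hne)
      set z'' := update z k (z' k) with hz''
      have hcard : (univ.filter (fun j => z'' j ≠ z' j)).card ≤ d := by
        have hsub : univ.filter (fun j => z'' j ≠ z' j) ⊆ (univ.filter (fun j => z j ≠ z' j)).erase k := by
          intro j hj
          rw [Finset.mem_filter] at hj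
          rw [Finset.mem_erase, Finset.mem_filter]
          by_cases hjk : j = k
          · subst hjk; rw [hz'', update_self] at hj; exact absurd rfl hj.2
          · rw [hz'', update_of_ne hjk] at hj; exact ⟨hjk, mem_univ _, hj.2⟩
        have hmem : k ∈ univ.filter (fun j => z j ≠ z' j) := Finset.mem_filter.mpr ⟨mem_univ _, hk⟩
        have := Finset.card_le_card hsub
        rw [Finset.card_erase_of_mem hmem] at this
        omega
      have hIH := ih z'' z' hcard
      -- `λ(z'')·ν(z_k) = λ(z)·ν(z'_k)` and `π̃(z'')·ν(z_k) = π̃(z)·ν(z'_k)`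
      have hfresh : lam (z'', ∅) * ν (z k) = lam (z, ∅) * ν (z' k) := hlam z ∅ k (z' k) (Finset.notMem_empty k)
      have hπ : tensorFun (fun _ : Fin (K + 1) => ν) z'' * ν (z k) = tensorFun (fun _ : Fin (K + 1) => ν) z * ν (z' k) :=
        tensorFun_update_mul_const ν z k (z' k)
      have hνk : ν (z' k) ≠ 0 := (hν _).ne'
      have hνzk : ν (z k) ≠ 0 := (hν _).ne'
      -- multiply the goal by `ν(z'_k)·ν(z_k)` and compute
      have key : lam (z, ∅) * tensorFun (fun _ : Fin (K + 1) => ν) z' * (ν (z' k) * ν (z k))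
          = lam (z', ∅) * tensorFun (fun _ : Fin (K + 1) => ν) z * (ν (z' k) * ν (z k)) := by
        calc lam (z, ∅) * tensorFun (fun _ : Fin (K + 1) => ν) z' * (ν (z' k) * ν (z k))
            = (lam (z, ∅) * ν (z' k)) * tensorFun (fun _ : Fin (K + 1) => ν) z' * ν (z k) := by ring
          _ = (lam (z'', ∅) * ν (z k)) * tensorFun (fun _ : Fin (K + 1) => ν) z' * ν (z k) := by rw [hfresh]
          _ = (lam (z'', ∅) * tensorFun (fun _ : Fin (K + 1) => ν) z') * (ν (z k) * ν (z k)) := by ring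
          _ = (lam (z', ∅) * tensorFun (fun _ : Fin (K + 1) => ν) z'') * (ν (z k) * ν (z k)) := by rw [hIH]
          _ = lam (z', ∅) * (tensorFun (fun _ : Fin (K + 1) => ν) z'' * ν (z k)) * ν (z k) := by ring
          _ = lam (z', ∅) * (tensorFun (fun _ : Fin (K + 1) => ν) z * ν (z' k)) * ν (z k) := by rw [hπ]
          _ = lam (z', ∅) * tensorFun (fun _ : Fin (K + 1) => ν) z * (ν (z' k) * ν (z k)) := by ring
      exact mul_right_cancel₀ (mul_ne_zero hνk hνzk) key

/-- **`ν̂_n(z, ∅) = (δ_{univ}Qⁿ)(∅)·π̃(z)`** — on the empty stale set the augmented law is the equilibrium `π̃` times the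
probability that the stale set is empty. [ours] -/
theorem ideal_lawAt_empty_eq (hν : ∀ v, 0 < ν v) (hν1 : ∑ v, ν v = 1) (hM : ∀ k, IsRowStochastic (M k))
    (hM0 : ∀ u v, M 0 u v = ν v)
    {Ph : (Fin (K + 1) → S) × Finset (Fin (K + 1)) → (Fin (K + 1) → S) × Finset (Fin (K + 1)) → ℝ}
    (hPh : ∀ p q, Ph p q = ∑ r : Fin m, t / m *
        (if q.1 = edgeFlowSwap (Equiv.refl S) 0 (κ r).succ p.1 ∧ q.2 = p.2.image (Equiv.swap (0 : Fin (K + 1)) (κ r).succ)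
          then (1 : ℝ) else 0)
      + (1 - t) * (coordKernel M 0 p.1 q.1 * (if q.2 = p.2.erase 0 then (1 : ℝ) else 0)))
    {Q : Finset (Fin (K + 1)) → Finset (Fin (K + 1)) → ℝ}
    (hQ : ∀ D D', Q D D' = ∑ r : Fin m, t / m * (if D' = D.image (Equiv.swap (0 : Fin (K + 1)) (κ r).succ) then (1 : ℝ)
      else 0) + (1 - t) * (if D' = D.erase 0 then (1 : ℝ) else 0))
    (x : Fin (K + 1) → S) (n : ℕ) (z : Fin (K + 1) → S) :
    lawAt Ph (Pi.single (x, (univ : Finset (Fin (K + 1)))) 1) n (z, ∅)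
      = lawAt Q (Pi.single (univ : Finset (Fin (K + 1))) 1) n ∅ * tensorFun (fun _ : Fin (K + 1) => ν) z := by
  have hprop := fresh_empty_proportional hν (ideal_fresh_lawAt κ hM0 hPh x n)
  have hπ1 : ∑ z', tensorFun (fun _ : Fin (K + 1) => ν) z' = 1 := sum_tensorFun_eq_one _ (fun _ => hν1)
  -- sum the proportionality over `z'`
  have hsum : lawAt Ph (Pi.single (x, (univ : Finset (Fin (K + 1)))) 1) n (z, ∅) * ∑ z', tensorFun (fun _ : Fin (K + 1) => ν) z'
      = (∑ z', lawAt Ph (Pi.single (x, (univ : Finset (Fin (K + 1)))) 1) n (z', ∅)) * tensorFun (fun _ : Fin (K + 1) => ν) z := by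
    rw [Finset.mul_sum, Finset.sum_mul]
    exact sum_congr rfl fun z' _ => hprop z z'
  rw [hπ1, mul_one, ideal_lawAt_snd κ hM hPh hQ x n ∅] at hsum
  exact hsum

/-! ## §3 Minorisation and the freshness bound -/

/-- **MINORISATION: `(δ_x Pⁿ)(z) ≥ (δ_{univ}Qⁿ)(∅)·π̃(z)`** for the idealised star, every start `x`. [ours] -/
theorem ideal_minorization (hm : 1 ≤ m) (ht0 : 0 ≤ t) (ht1 : t ≤ 1) (hν : ∀ v, 0 < ν v) (hν1 : ∑ v, ν v = 1)
    (hM : ∀ k, IsRowStochastic (M k)) (hM0 : ∀ u v, M 0 u v = ν v)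
    {Q : Finset (Fin (K + 1)) → Finset (Fin (K + 1)) → ℝ}
    (hQ : ∀ D D', Q D D' = ∑ r : Fin m, t / m * (if D' = D.image (Equiv.swap (0 : Fin (K + 1)) (κ r).succ) then (1 : ℝ)
      else 0) + (1 - t) * (if D' = D.erase 0 then (1 : ℝ) else 0))
    (x : Fin (K + 1) → S) (n : ℕ) (z : Fin (K + 1) → S) :
    lawAt Q (Pi.single (univ : Finset (Fin (K + 1))) 1) n ∅ * tensorFun (fun _ : Fin (K + 1) => ν) z
      ≤ lawAt (fun y z : Fin (K + 1) → S => t * ptGraphSwap (fun _ : Fin (K + 1) => ν)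
          (fun r : Fin m => (((0 : Fin (K + 1)), (κ r).succ) : Fin (K + 1) × Fin (K + 1))) (fun _ => Equiv.refl S) y z
          + (1 - t) * prodKernel (fun k : Fin (K + 1) => if k = 0 then (1 : ℝ) else 0) M y z) (Pi.single x 1) n z := by
  set Ph : (Fin (K + 1) → S) × Finset (Fin (K + 1)) → (Fin (K + 1) → S) × Finset (Fin (K + 1)) → ℝ :=
    fun p q => ∑ r : Fin m, t / m *
        (if q.1 = edgeFlowSwap (Equiv.refl S) 0 (κ r).succ p.1 ∧ q.2 = p.2.image (Equiv.swap (0 : Fin (K + 1)) (κ r).succ)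
          then (1 : ℝ) else 0)
      + (1 - t) * (coordKernel M 0 p.1 q.1 * (if q.2 = p.2.erase 0 then (1 : ℝ) else 0)) with hPh_def
  have hPh : ∀ p q, Ph p q = ∑ r : Fin m, t / m *
        (if q.1 = edgeFlowSwap (Equiv.refl S) 0 (κ r).succ p.1 ∧ q.2 = p.2.image (Equiv.swap (0 : Fin (K + 1)) (κ r).succ)
          then (1 : ℝ) else 0)
      + (1 - t) * (coordKernel M 0 p.1 q.1 * (if q.2 = p.2.erase 0 then (1 : ℝ) else 0)) := fun p q => rfl
  rw [← ideal_lawAt_fst κ hm hν hPh x n z, ← ideal_lawAt_empty_eq κ hν hν1 hM hM0 hPh hQ x n z]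
  have hnn : ∀ q, 0 ≤ lawAt Ph (Pi.single (x, (univ : Finset (Fin (K + 1)))) 1) n q := fun q =>
    lawAt_nonneg (ideal_aug_isRowStochastic κ hm ht0 ht1 hM hPh) (fun p => by
      by_cases h : p = (x, (univ : Finset (Fin (K + 1))))
      · subst h; rw [Pi.single_eq_same]; norm_num
      · rw [Pi.single_eq_of_ne h]) n q
  exact Finset.single_le_sum (f := fun D => lawAt Ph (Pi.single (x, (univ : Finset (Fin (K + 1)))) 1) n (z, D))
    (fun D _ => hnn (z, D)) (mem_univ ∅)

omit [DecidableEq S] in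
/-- A probability vector minorised by `c·π` (`π` a probability vector) is within `1 − c` of `π` in total variation.
[ours] -/
theorem tvDist_le_of_pointwise_ge {X : Type*} [Fintype X] [DecidableEq X] {μ π : X → ℝ} (hπ0 : ∀ x, 0 ≤ π x)
    (hπ1 : ∑ x, π x = 1) (hμ1 : ∑ x, μ x = 1) {c : ℝ} (hmin : ∀ x, c * π x ≤ μ x) : tvDist μ π ≤ 1 - c := by
  rw [tvDist_comm, tvDist_eq_sum_filter (by rw [hπ1, hμ1])]
  calc ∑ x ∈ univ.filter (fun x => μ x ≤ π x), (π x - μ x)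
      ≤ ∑ x ∈ univ.filter (fun x => μ x ≤ π x), (1 - c) * π x :=
        sum_le_sum fun x _ => by linarith [hmin x]
    _ ≤ ∑ x, (1 - c) * π x := by
        refine Finset.sum_le_univ_sum_of_nonneg fun x => mul_nonneg ?_ (hπ0 x)
        -- `c ≤ 1`: from the minorisation summed, `c = c·Σπ ≤ Σμ = 1`
        have : c * ∑ x, π x ≤ ∑ x, μ x := by rw [Finset.mul_sum]; exact sum_le_sum fun x _ => hmin x
        rw [hπ1, hμ1, mul_one] at this
        linarith
    _ = 1 - c := by rw [← Finset.mul_sum, hπ1, mul_one]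

/-- **THE FRESHNESS BOUND: `‖δ_x Pⁿ − π̃‖_TV ≤ (δ_{univ}Qⁿ){D ≠ ∅}`** for the idealised star from every start. [ours] -/
theorem ideal_tvDist_le_stale (hm : 1 ≤ m) (ht0 : 0 ≤ t) (ht1 : t ≤ 1) (hν : ∀ v, 0 < ν v) (hν1 : ∑ v, ν v = 1)
    (hM : ∀ k, IsRowStochastic (M k)) (hM0 : ∀ u v, M 0 u v = ν v)
    {Q : Finset (Fin (K + 1)) → Finset (Fin (K + 1)) → ℝ}
    (hQ : ∀ D D', Q D D' = ∑ r : Fin m, t / m * (if D' = D.image (Equiv.swap (0 : Fin (K + 1)) (κ r).succ) then (1 : ℝ)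
      else 0) + (1 - t) * (if D' = D.erase 0 then (1 : ℝ) else 0))
    (x : Fin (K + 1) → S) (n : ℕ) :
    tvDist (lawAt (fun y z : Fin (K + 1) → S => t * ptGraphSwap (fun _ : Fin (K + 1) => ν)
          (fun r : Fin m => (((0 : Fin (K + 1)), (κ r).succ) : Fin (K + 1) × Fin (K + 1))) (fun _ => Equiv.refl S) y z
          + (1 - t) * prodKernel (fun k : Fin (K + 1) => if k = 0 then (1 : ℝ) else 0) M y z) (Pi.single x 1) n)
        (tensorFun (fun _ : Fin (K + 1) => ν))
      ≤ ∑ D ∈ univ.filter (fun D : Finset (Fin (K + 1)) => D ≠ ∅), lawAt Q (Pi.single (univ : Finset (Fin (K + 1))) 1) n D := by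
  have hμ : ∀ (k : Fin (K + 1)) (v : S), 0 < (fun _ : Fin (K + 1) => ν) k v := fun _ v => hν v
  have hw0 : ∀ k : Fin (K + 1), 0 ≤ (if k = 0 then (1 : ℝ) else 0) := fun k => by split_ifs <;> norm_num
  have hw1 : ∑ k : Fin (K + 1), (if k = 0 then (1 : ℝ) else 0) = 1 := by
    rw [Finset.sum_ite_eq' univ (0 : Fin (K + 1)), if_pos (mem_univ _)]
  have hP := weightedScheme_isRowStochastic (t := t) (w := fun k : Fin (K + 1) => if k = 0 then (1 : ℝ) else 0)
    (ptGraphSwap_isRowStochastic (e := fun r : Fin m => (((0 : Fin (K + 1)), (κ r).succ) : Fin (K + 1) × Fin (K + 1)))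
      (φ := fun _ => Equiv.refl S) hμ) hM hw0 hw1 ht0 ht1
  have hQst := dirty_isRowStochastic κ hm ht0 ht1 hQ
  have hmassQ : ∑ D, lawAt Q (Pi.single (univ : Finset (Fin (K + 1))) 1) n D = 1 := by
    rw [sum_lawAt hQst, Finset.sum_pi_single', if_pos (mem_univ _)]
  have hsplit := Finset.sum_filter_add_sum_filter_not univ (fun D : Finset (Fin (K + 1)) => D ≠ ∅)
    (fun D => lawAt Q (Pi.single (univ : Finset (Fin (K + 1))) 1) n D)
  have hE : univ.filter (fun D : Finset (Fin (K + 1)) => ¬D ≠ ∅) = {∅} := by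
    ext D; simp only [Finset.mem_filter, Finset.mem_univ, true_and, not_not, Finset.mem_singleton]
  rw [hmassQ, hE, Finset.sum_singleton] at hsplit
  have htv := tvDist_le_of_pointwise_ge (fun z => (tensorFun_pos hμ z).le) (sum_tensorFun_eq_one _ (fun _ => hν1))
    (by rw [sum_lawAt hP, Finset.sum_pi_single', if_pos (mem_univ _)])
    (fun z => ideal_minorization κ hm ht0 ht1 hν hν1 hM hM0 hQ x n z)
  linarith

end Fresh

end Summit.Ventures.LatticeQCDFlow.Scaling

end
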